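import Summits.BirchSwinnertonDyer.Rank1Residual.P2.CongruentNumberSilentEvenFiveEnclosureMonskyExact
import HarnessLib

/-!
# Observable ⟹ sharper with NO hypothesis: the `Ш_an`-unit form of C-P2-1 on `𝒮⁻` and of the uniform law
# C-P2-2 at every `k` follows from the observable form (a)+(b) with no displayed fact and no GZK binder
# (the rank is read off Miller's `BSD(E, 2)` itself; the `2`-Selmer bound is the tree's complete `2`-descent)

HONEST FRAMING (cell `bsd-monsky`, run/shared/lean/pub/bsd-monsky/; README §1): ONE theorem on ONE explicit infinite
family of quadratic twists of the congruent number curve at the prime `2`; nothing is booked by this file; every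
declaration is a kernel implication between conjecture `Prop`s and asserts neither side. WHAT IT DOES. The cell's
bookkeeping «observable ⟺ sharper» took a binder on the `⟹` direction that is not needed: the landed proofs
`Conjectures.congruentSilentEvenFiveOrdTwo_of_bsdTwo (h515)` and `Conjectures.congruentEvenOrdTwoAt_of_bsdTwoAt_descent (hGZK)`
obtain rank one from Monsky's Cor. 5.15 resp. from Gross–Zagier–Kolyvagin, while Miller's `BSD(E, 2)` (Def. 1.1 (i))
already CONTAINS `rank_ℤ E(ℚ) = ord_{s=1} L(E, s)`; with `ord_{s=1} L = 1` that is rank one, the tree's complete `2`-descent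
gives `#Sel₂ ≤ 8` (`#Sel₂ ≤ 2^{2+s}` with `s = 1`), Silverman X.4.2 gives `Ш[2^∞] = 0`, and the unfolding of
`#Ш_an = L′·#tors²/(Ω·∏c·Reg)` is the landed computation. So: **the `Ш_an`-unit form (what the pre-registered runs
P-T15b/c/d measured) follows from the observable form WITH NO HYPOTHESIS**, on `𝒮⁻` (§1) and at every `k` (§2); the
converse keeps exactly one binder — rank one per member on `𝒮⁻` (`…_of_ordTwo_monskyExact`), or GZK —, so the two typed
forms of C-P2-1 are equivalent modulo rank one ALONE (§1) and those of C-P2-2 modulo GZK in the `⟸` direction only (§2).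
[cite: Miller2011LMS, Def. 1.1 (arXiv:1010.2431 p. 3)] [cite: SilvermanAEC2009, Prop. X.1.4, Prop. X.4.9, Thm. X.4.2]
[cite: HeathBrown1994SelmerCongruentII, Appendix (Monsky), typescript p. 41 L20–L36]
[cite: KoblitzECMF1993, Ch. II §5, Theorem (p. 84)]
-/

noncomputable section

open scoped Classical

open WeierstrassCurve Literature.NumberTheory.EllipticCurves
  Literature.NumberTheory.EllipticCurves.Rank1Residual
  Literature.NumberTheory.EllipticCurves.Rank1Residual.Typed
  Literature.NumberTheory.EllipticCurves.HeathBrown1994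

set_option autoImplicit false

namespace Summit.BirchSwinnertonDyer.Rank1Residual.P2

namespace Conjectures

/-! ## §1 C-P2-1 on `𝒮⁻`: observable ⟹ sharper with no hypothesis; the two forms equivalent modulo rank one alone -/

/-- **Observable ⟹ sharper on `𝒮⁻`, with NO hypothesis.** Given `ord_{s=1} L(E_{2pq}, s) = 1` and Miller's `BSD(E_{2pq}, 2)`:
clause (i) of `BSD(E, 2)` is `rank E_{2pq}(ℚ) = ord_{s=1} L = 1`; the tree's complete `2`-descent gives `#Sel₂(E_{2pq}) ≤ 8`
(`card_selmerGroup_two_le_eight_congruentNumberCurve_two_mul_of_jacobiSym_eq_neg_one`), so `Ш(E_{2pq})[2^∞] = 0`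
(Silverman X.4.2 with `#E(ℚ)[2] = 4`); Miller's clause (iv) supplies `#Ш_an = y ∈ ℚ` with `ord₂ y = 0`; unfolding
`#Ш_an = L′·#tors²/(Ω·∏c·Reg)` with `#tors = 4`, `∏c = 2⁶` gives `L′ = (4y)·Ω·Reg`, `ord₂(4y) = 2`. The proof of
`congruentSilentEvenFiveOrdTwo_of_bsdTwo (h515)` verbatim with its one use of Cor. 5.15 replaced by clause (i) + the descent
bound. A kernel implication between conjecture `Prop`s; asserts neither.
[cite: Miller2011LMS, §1 and Def. 1.1 (arXiv:1010.2431 p. 3)] [cite: SilvermanAEC2009, Prop. X.1.4, Prop. X.4.9, Thm. X.4.2] -/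
theorem congruentSilentEvenFiveOrdTwo_of_bsdTwo_unconditional (h : CongruentSilentEvenFiveBSDTwo) :
    CongruentSilentEvenFiveOrdTwo := by
  intro p q hp hq hp5 hq4 hj
  obtain ⟨hN, hp2, hq2, hne⟩ := isCor515Family_two_mul_five_mul hp hq hp5 hq4
  haveI := isElliptic_congruentNumberCurve hN.ne_zero
  haveI : Fact (Nat.Prime 2) := ⟨Nat.prime_two⟩
  obtain ⟨hr1, hbsd⟩ := h p q hp hq hp5 hq4 hj
  obtain ⟨hrank, -, y, hy, hval⟩ := hbsd
  -- Miller (i): rank one; the descent bound: `#Sel₂ ≤ 8`; hence `Ш[2^∞] = 0` and `ord₂ y = 0`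
  rw [hr1] at hrank
  have hsel : Nat.card ((congruentNumberCurve (2 * (p * q))).selmerGroup 2) ≤ 8 :=
    card_selmerGroup_two_le_eight_congruentNumberCurve_two_mul_of_jacobiSym_eq_neg_one hp hq hp5 hq4 hj
  have hbot := primaryComponent_sha_two_eq_bot_of_card_selmerGroup_le_eight hN.ne_zero hrank hsel
  have hcard : Nat.card (AddCommGroup.primaryComponent (congruentNumberCurve (2 * (p * q))).sha 2) = 1 := by
    rw [hbot]; exact AddSubgroup.card_bot
  rw [hcard, padicValNat_one_right, Nat.cast_zero] at hval
  -- the leading coefficient is `L′(E,1) ≠ 0`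
  obtain ⟨hlead, hder⟩ := leadingLCoeff_eq_deriv_of_analyticRank_eq_one hr1
  have hT := torsionOrder_congruentNumberCurve hN.squarefree
  obtain ⟨-, htam⟩ := twoExponent_tamagawa_two_mul_prime_mul hp hq hp2 hq2 hne
  have hΩ : ((congruentNumberCurve (2 * (p * q))).realPeriodRat : ℂ) ≠ 0 := by
    exact_mod_cast (congruentNumberCurve (2 * (p * q))).realPeriodRat_pos_holds.ne'
  have hR : ((congruentNumberCurve (2 * (p * q))).regulator : ℂ) ≠ 0 := by
    exact_mod_cast (congruentNumberCurve (2 * (p * q))).regulator_pos'.ne'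
  -- unfold `#Ш_an` and solve for `L′`
  have hsha := hy
  rw [shaAn_def, hlead, hT, htam] at hsha
  push_cast at hsha
  have hderiv : deriv (congruentNumberCurve (2 * (p * q))).entireLFunction 1 =
      ((y * 4 : ℚ) : ℂ) * ((congruentNumberCurve (2 * (p * q))).realPeriodRat : ℂ) *
        ((congruentNumberCurve (2 * (p * q))).regulator : ℂ) := by
    rw [div_eq_iff (mul_ne_zero (mul_ne_zero hΩ (by norm_num)) hR)] at hsha
    push_cast
    linear_combination (1 / 16 : ℂ) * hsha
  have hy0 : y ≠ 0 := by
    rintro rfl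
    apply hder
    rw [hderiv]; push_cast; ring
  refine ⟨y * 4, mul_ne_zero hy0 four_ne_zero, hderiv, ?_⟩
  rw [padicValRat.mul hy0 four_ne_zero, hval, show (4 : ℚ) = ((2 ^ 2 : ℕ) : ℚ) by norm_num,
    padicValRat.of_nat, padicValNat.prime_pow]
  norm_num

/-- **C-P2-1: observable ⟺ sharper on `𝒮⁻` modulo rank one per member ALONE** (no Cor. 5.15, no `2`-Selmer fact, no GZK):
`⟸` is `congruentSilentEvenFiveBSDTwo_of_ordTwo_monskyExact (hrank)`, `⟹` needs nothing. Neither side is asserted.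
[cite: Miller2011LMS, Def. 1.1 (arXiv:1010.2431 p. 3)] [cite: SilvermanAEC2009, Thm. X.4.2]
[cite: HeathBrown1994SelmerCongruentII, Appendix (Monsky), typescript p. 41 L20–L36] -/
theorem congruentSilentEvenFiveBSDTwo_iff_ordTwo_of_rank
    (hrank : ∀ p q : ℕ, p.Prime → q.Prime → p % 8 = 5 → q % 4 = 3 → jacobiSym p q = -1 →
      (congruentNumberCurve (2 * (p * q))).mordellWeilRank = 1) :
    CongruentSilentEvenFiveBSDTwo ↔ CongruentSilentEvenFiveOrdTwo :=
  ⟨congruentSilentEvenFiveOrdTwo_of_bsdTwo_unconditional, congruentSilentEvenFiveBSDTwo_of_ordTwo_monskyExact hrank⟩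

/-- **Sharper ⟹ observable on `𝒮⁻` modulo GZK alone**: the datum `x ≠ 0` gives `L′(E_{2pq}, 1) ≠ 0`, hence
`ord_{s=1} L = 1` (root number `−1` for `2pq ≡ 6 (mod 8)`), GZK gives rank one, and `…_of_ordTwo_monskyExact` does the rest.
A kernel implication between conjecture `Prop`s; asserts neither. [cite: Darmon2004, Thm. 3.22 (= Thm. 1.14)]
[cite: KoblitzECMF1993, Ch. II §5, Theorem (p. 84)] [cite: Miller2011LMS, Def. 1.1 (arXiv:1010.2431 p. 3)] -/
theorem congruentSilentEvenFiveBSDTwo_of_ordTwo_gzk (hGZK : rank_eq_analyticRank_of_analyticRank_le_one)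
    (h : CongruentSilentEvenFiveOrdTwo) : CongruentSilentEvenFiveBSDTwo := by
  refine congruentSilentEvenFiveBSDTwo_of_ordTwo_monskyExact ?_ h
  intro p q hp hq hp5 hq4 hj
  obtain ⟨hN, -, -, -⟩ := isCor515Family_two_mul_five_mul hp hq hp5 hq4
  haveI := isElliptic_congruentNumberCurve hN.ne_zero
  obtain ⟨x, hx0, hx, -⟩ := h p q hp hq hp5 hq4 hj
  have hΩ : ((congruentNumberCurve (2 * (p * q))).realPeriodRat : ℂ) ≠ 0 := by
    exact_mod_cast (congruentNumberCurve (2 * (p * q))).realPeriodRat_pos_holds.ne'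
  have hR : ((congruentNumberCurve (2 * (p * q))).regulator : ℂ) ≠ 0 := by
    exact_mod_cast (congruentNumberCurve (2 * (p * q))).regulator_pos'.ne'
  have hder : deriv (congruentNumberCurve (2 * (p * q))).entireLFunction 1 ≠ 0 := by
    rw [hx]
    exact mul_ne_zero (mul_ne_zero (by exact_mod_cast hx0) hΩ) hR
  have hr1 : (congruentNumberCurve (2 * (p * q))).analyticRank = 1 :=
    analyticRank_congruentNumberCurve_eq_one_of_deriv_ne_zero hN.squarefree hN.mod_eight hder
  obtain ⟨hrank, -⟩ := hGZK (congruentNumberCurve (2 * (p * q))) (le_of_eq hr1)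
  rw [hrank, hr1]

/-- **C-P2-1: observable ⟺ sharper on `𝒮⁻` modulo GZK alone** (`⟹` needs nothing). Neither side is asserted.
[cite: Darmon2004, Thm. 3.22 (= Thm. 1.14)] [cite: Miller2011LMS, Def. 1.1 (arXiv:1010.2431 p. 3)] -/
theorem congruentSilentEvenFiveBSDTwo_iff_ordTwo_gzk (hGZK : rank_eq_analyticRank_of_analyticRank_le_one) :
    CongruentSilentEvenFiveBSDTwo ↔ CongruentSilentEvenFiveOrdTwo :=
  ⟨congruentSilentEvenFiveOrdTwo_of_bsdTwo_unconditional, congruentSilentEvenFiveBSDTwo_of_ordTwo_gzk hGZK⟩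

/-! ## §2 The uniform law C-P2-2 at every `k`: observable ⟹ sharper with no hypothesis -/

/-- **Observable ⟹ sharper at every `k`, with NO hypothesis**: the proof of `congruentEvenOrdTwoAt_of_bsdTwoAt_descent (hGZK)`
verbatim with rank one read off Miller's clause (i) instead of GZK (`#Sel₂ ≤ 8` from the tree's `2`-descent with `s(n) = 1`,
`Ш[2^∞] = 0` by Silverman X.4.2, `∏c = 2^{2k+2}`, `L′ = (y·2^{2k+2}/16)·Ω·Reg`, `ord₂ = 2k − 2`). Asserts neither `Prop`.
[cite: Miller2011LMS, §1 and Def. 1.1 (arXiv:1010.2431 p. 3)] [cite: SilvermanAEC2009, Prop. X.1.4, Prop. X.4.9, Thm. X.4.2]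
[cite: SilvermanATAEC1994, IV.9.4, Table 4.1] [cite: HeathBrown1994SelmerCongruentII, Appendix (Monsky), typescript p. 41 L20–L36] -/
theorem congruentEvenOrdTwoAt_of_bsdTwoAt_unconditional {k : ℕ} (h : CongruentEvenBSDTwoAt k) :
    CongruentEvenOrdTwoAt k := by
  intro p hp hinj h8 hs
  have hodd : ∀ i, Odd (p i) := odd_of_two_mul_prod_mod_eight_six p rfl h8
  have hsq : Squarefree (2 * ∏ i, p i) := squarefree_two_mul_prod_of_injective p hp hodd hinj
  have hn0 : 2 * ∏ i, p i ≠ 0 := hsq.ne_zero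
  haveI := isElliptic_congruentNumberCurve hn0
  haveI : Fact (Nat.Prime 2) := ⟨Nat.prime_two⟩
  obtain ⟨hr1, hbsd⟩ := h p hp hinj h8 hs
  obtain ⟨hrank, -, y, hy, hval⟩ := hbsd
  rw [hr1] at hrank
  have hsel : Nat.card ((congruentNumberCurve (2 * ∏ i, p i)).selmerGroup 2) ≤ 8 :=
    card_selmerGroup_two_le_eight_of_monskySelmerRankEven_eq_one p hp hodd hinj hs
  have hbot := primaryComponent_sha_two_eq_bot_of_card_selmerGroup_le_eight hn0 hrank hsel
  have hcard : Nat.card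
      (AddCommGroup.primaryComponent (congruentNumberCurve (2 * ∏ i, p i)).sha 2) = 1 := by
    rw [hbot]; exact AddSubgroup.card_bot
  rw [hcard, padicValNat_one_right, Nat.cast_zero] at hval
  obtain ⟨hlead, hder⟩ := leadingLCoeff_eq_deriv_of_analyticRank_eq_one hr1
  have hT := torsionOrder_congruentNumberCurve hsq
  have htam : (congruentNumberCurve (2 * ∏ i, p i)).tamagawaProduct = 2 ^ (2 * k + 2) :=
    tamagawaProduct_congruentNumberCurve_two_mul_prod p hp hodd hinj rfl
  have hΩ : ((congruentNumberCurve (2 * ∏ i, p i)).realPeriodRat : ℂ) ≠ 0 := by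
    exact_mod_cast (congruentNumberCurve (2 * ∏ i, p i)).realPeriodRat_pos_holds.ne'
  have hR : ((congruentNumberCurve (2 * ∏ i, p i)).regulator : ℂ) ≠ 0 := by
    exact_mod_cast (congruentNumberCurve (2 * ∏ i, p i)).regulator_pos'.ne'
  have h2 : (2 : ℂ) ^ (2 * k + 2) ≠ 0 := pow_ne_zero _ two_ne_zero
  have hsha := hy
  rw [shaAn_def, hlead, hT, htam] at hsha
  push_cast at hsha
  have hderiv : deriv (congruentNumberCurve (2 * ∏ i, p i)).entireLFunction 1 =
      ((y * 2 ^ (2 * k + 2) / 16 : ℚ) : ℂ) *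
        ((congruentNumberCurve (2 * ∏ i, p i)).realPeriodRat : ℂ) *
          ((congruentNumberCurve (2 * ∏ i, p i)).regulator : ℂ) := by
    rw [div_eq_iff (mul_ne_zero (mul_ne_zero hΩ h2) hR)] at hsha
    push_cast
    linear_combination (1 / 16 : ℂ) * hsha
  have hy0 : y ≠ 0 := by
    rintro rfl
    apply hder
    rw [hderiv]; push_cast; ring
  have hy2 : y * 2 ^ (2 * k + 2) ≠ 0 := mul_ne_zero hy0 (pow_ne_zero _ two_ne_zero)
  refine ⟨y * 2 ^ (2 * k + 2) / 16, div_ne_zero hy2 (by norm_num), hderiv, ?_⟩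
  rw [padicValRat.div hy2 (by norm_num), padicValRat.mul hy0 (pow_ne_zero _ two_ne_zero), hval,
    show ((2 : ℚ) ^ (2 * k + 2)) = ((2 ^ (2 * k + 2) : ℕ) : ℚ) by push_cast; rfl,
    show (16 : ℚ) = ((2 ^ 4 : ℕ) : ℚ) by norm_num, padicValRat.of_nat, padicValRat.of_nat,
    padicValNat.prime_pow, padicValNat.prime_pow]
  push_cast
  ring

/-- **C-P2-2, uniform: observable ⟹ sharper with NO hypothesis** (`CongruentEvenMonskyBSDTwo → CongruentEvenMonskyOrdTwo`).
Neither conjecture is asserted. [cite: Miller2011LMS, Def. 1.1 (arXiv:1010.2431 p. 3)] [cite: SilvermanAEC2009, Thm. X.4.2] -/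
theorem congruentEvenMonskyOrdTwo_of_bsdTwo_unconditional (h : CongruentEvenMonskyBSDTwo) : CongruentEvenMonskyOrdTwo :=
  fun k hk => congruentEvenOrdTwoAt_of_bsdTwoAt_unconditional (h k hk)

end Conjectures

end Summit.BirchSwinnertonDyer.Rank1Residual.P2

end
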